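import Literature.MathematicalPhysics.QuantumLattice.StaggeredGaugeReflectionPositivitySchwarz
import Literature.MathematicalPhysics.QuantumLattice.StaggeredChiralWardIdentity
import HarnessLib

/-!
# The chiral Ward identity and the `m = 0` selection rules of staggered fermions at every gauge coupling

The tree's `StaggeredChiralWardIdentity` proves Salmhofer–Seiler's chiral Ward identity (3.43) and
the `m = 0` selection rules (p. 400; (3.101)/(3.106)) AT FIXED GAUGE FIELD, hence for the `β = 0`
expectation.  Integrating the fixed-gauge identities against the Wilson probability measure `dμ_β`
gives them for the COUPLED expectation `⟨·⟩_{β,m}` of `StaggeredGaugeReflectionPositivity`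
(compact `G`, continuous unitary `ρ`, antiperiodic staggered signs, even torus `(ℤ/Lℤ)^d`) at EVERY
real `β` — the remark of Salmhofer–Seiler §2 (after (2.7)) that the `U(1)` chiral symmetry at `m = 0`,
and its consequences, do not depend on `βS_g`:

* `ward_identity_bracket`, **`ward_identity_expect`** — (3.43) at every `β`:
  `ε(y) ⟨ψ̄ψ(y)⟩_{β,m} = −m Σ_x ε(x) ⟨ψ̄ψ(x) ψ̄ψ(y)⟩_{β,m}`, `ε(x) = (−1)^{Σ_ν x_ν}`;
* `bracket_meson_massZero`, **`expect_meson_massZero`** — `⟨ψ̄ψ(y)⟩_{β,0} = 0` (no spontaneous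
  breaking in finite volume, p. 400, at every `β`);
* `twoPoint_chiralGrading_bracket`, **`expect_meson_meson_massZero`** — (3.101)/(3.106) at every
  `β`: `ε(x)ε(y)⟨ψ̄ψ(x)ψ̄ψ(y)⟩_{β,0} = −⟨ψ̄ψ(x)ψ̄ψ(y)⟩_{β,0}`, so the `m = 0` two-point function
  vanishes between sites of equal parity (`T̂(k + π̂) = −T̂(k)`).

Everything is proved; no named fact.  Scope: finite even torus, real `m`, fixed lattice spacing.

## Sources

M. Salmhofer, E. Seiler, CMP 139 (1991) 395, §2 (2.7), p. 400, (3.43), (3.101), (3.106) [`SalmhoferSeiler1991`].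
-/

noncomputable section

open scoped ComplexConjugate Matrix ComplexOrder
open MeasureTheory

namespace Literature.MathematicalPhysics.QuantumLattice

namespace StaggeredRP

open Literature.MathematicalPhysics.QuantumFieldTheory
open Literature.MathematicalPhysics.QuantumFieldTheory.WilsonRP
open Literature.MathematicalPhysics.StatisticalMechanics
open GrassmannAlgebra StrongCoupling

variable {d L N : ℕ} [NeZero d] [NeZero L] [Fact (1 < L)] [LinearOrder (Site d L)]
variable {G : Type*} [Group G] [TopologicalSpace G] [IsTopologicalGroup G] [CompactSpace G]
  [MeasurableSpace G] [BorelSpace G] (ρ : G →* Matrix.unitaryGroup (Fin N) ℂ)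

/-- The staggered (axial) sign `ε(x) = (−1)^{Σ_ν x_ν}` of an even torus, as a complex number
(`ComplexSpin.sgn`). [cite: SalmhoferSeiler1991, §2 (2.8)] -/
abbrev axialSign (hL : Even L) (x : Site d L) : ℂ := ((ComplexSpin.sgn (even_iff_two_dvd.1 hL) x : ℤ) : ℂ)

omit [Fact (1 < L)] [TopologicalSpace G] [IsTopologicalGroup G] [CompactSpace G] [MeasurableSpace G] [BorelSpace G] in
/-- The fermionic integral of `StaggeredGaugeReflectionPositivity` in terms of the tree's
`fermiBoltzmann` on the torus links with the antiperiodic staggered signs. [cite: SalmhoferSeiler1991, §2 (2.9)] -/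
theorem fermiIntegrand_eq_berezin_fermiBoltzmann (m : ℝ) (Φ : GaugeConfig d L G → FermiAlg (Site d L) N)
    (U : GaugeConfig d L G) :
    fermiIntegrand ρ m Φ U =
      berezin ℂ _ (Φ U * StrongCoupling.fermiBoltzmann (torusLinks d L) apSign (m : ℂ) fun e => ρ (U e)) := rfl

/-! ## The chiral Ward identity (3.43) at every `β` -/

omit [Fact (1 < L)] in
/-- **The chiral Ward identity (3.43) for the un-normalised coupled expectation at every real `β`**:
`ε(y) ⟨⟨ψ̄ψ(y)⟩⟩_{β,m} = −m Σ_x ε(x) ⟨⟨ψ̄ψ(x) ψ̄ψ(y)⟩⟩_{β,m}`. [cite: SalmhoferSeiler1991, (3.43)] -/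
theorem ward_identity_bracket (hL : Even L) (hρ : Continuous ρ) (β m : ℝ) (y : Site d L) :
    axialSign hL y * bracket ρ β m (fun _ : GaugeConfig d L G => (meson y : FermiAlg (Site d L) N)) =
      -(m : ℂ) * ∑ x, axialSign hL x *
        bracket ρ β m (fun _ : GaugeConfig d L G => (meson x * meson y : FermiAlg (Site d L) N)) := by
  have hfix : ∀ U : GaugeConfig d L G,
      axialSign hL y * fermiIntegrand ρ m (fun _ => (meson y : FermiAlg (Site d L) N)) U =
        -(m : ℂ) * ∑ x, axialSign hL x * fermiIntegrand ρ m (fun _ => (meson x * meson y : FermiAlg (Site d L) N)) U :=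
    fun U => ward_identity_torus_fixedGauge (even_iff_two_dvd.1 hL) NeZero.one_le apSign (m : ℂ) (fun e => ρ (U e)) y
  have hint : ∀ x : Site d L, Integrable
      (fun U => axialSign hL x * fermiIntegrand ρ m (fun _ => (meson x * meson y : FermiAlg (Site d L) N)) U)
      (wilsonMeasure (repMat ρ) β) :=
    fun x => (integrable_fermiIntegrand ρ hρ β m (coeffRegular_const _)).const_mul _
  unfold bracket wilsonExpectation
  rw [← integral_const_mul, integral_congr_ae (ae_of_all _ hfix), integral_const_mul,
    integral_finsetSum _ fun x _ => hint x]
  congr 1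
  exact Finset.sum_congr rfl fun x _ => integral_const_mul _ _

omit [Fact (1 < L)] in
/-- **The chiral Ward identity (3.43) for the coupled expectation at every real `β`**:
`ε(y) ⟨ψ̄ψ(y)⟩_{β,m} = −m Σ_x ε(x) ⟨ψ̄ψ(x) ψ̄ψ(y)⟩_{β,m}`. [cite: SalmhoferSeiler1991, (3.43)] -/
theorem ward_identity_expect (hL : Even L) (hρ : Continuous ρ) (β m : ℝ) (y : Site d L) :
    axialSign hL y * expect ρ β m (fun _ : GaugeConfig d L G => (meson y : FermiAlg (Site d L) N)) =
      -(m : ℂ) * ∑ x, axialSign hL x *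
        expect ρ β m (fun _ : GaugeConfig d L G => (meson x * meson y : FermiAlg (Site d L) N)) := by
  simp only [expect, mul_div_assoc', ← Finset.sum_div, ward_identity_bracket ρ hL hρ β m y]

/-! ## The `m = 0` selection rules at every `β` -/

omit [Fact (1 < L)] in
/-- **`⟨⟨ψ̄ψ(y)⟩⟩_{β,0} = 0`** at every real `β` (even `L`). [cite: SalmhoferSeiler1991, §2 p. 400 ((2.13)–(2.14))] -/
theorem bracket_meson_massZero (hL : Even L) (β : ℝ) (y : Site d L) :
    bracket ρ β 0 (fun _ : GaugeConfig d L G => (meson y : FermiAlg (Site d L) N)) = 0 := by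
  unfold bracket wilsonExpectation
  refine (integral_congr_ae (ae_of_all _ fun U => ?_)).trans (integral_zero _ _)
  show fermiIntegrand ρ 0 (fun _ => (meson y : FermiAlg (Site d L) N)) U = (0 : ℂ)
  rw [fermiIntegrand_eq_berezin_fermiBoltzmann, Complex.ofReal_zero]
  exact berezin_meson_torus_massZero (even_iff_two_dvd.1 hL) NeZero.one_le apSign _ y

omit [Fact (1 < L)] in
/-- **`⟨ψ̄ψ(y)⟩_{β,0} = 0`**: no chiral condensate at `m = 0` in finite volume, at every real `β`
(even `L`). [cite: SalmhoferSeiler1991, §2 p. 400 ((2.13)–(2.14))] -/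
theorem expect_meson_massZero (hL : Even L) (β : ℝ) (y : Site d L) :
    expect ρ β 0 (fun _ : GaugeConfig d L G => (meson y : FermiAlg (Site d L) N)) = 0 := by
  rw [expect, bracket_meson_massZero ρ hL, zero_div]

omit [Fact (1 < L)] in
/-- **(3.101)/(3.106) for the un-normalised coupled expectation at every real `β`**: at `m = 0`,
`ε(x)ε(y) ⟨⟨ψ̄ψ(x)ψ̄ψ(y)⟩⟩_{β,0} = −⟨⟨ψ̄ψ(x)ψ̄ψ(y)⟩⟩_{β,0}`. [cite: SalmhoferSeiler1991, (3.101) and (3.106)] -/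
theorem twoPoint_chiralGrading_bracket (hL : Even L) (β : ℝ) (x y : Site d L) :
    axialSign hL x * axialSign hL y *
        bracket ρ β 0 (fun _ : GaugeConfig d L G => (meson x * meson y : FermiAlg (Site d L) N)) =
      -bracket ρ β 0 (fun _ : GaugeConfig d L G => (meson x * meson y : FermiAlg (Site d L) N)) := by
  unfold bracket wilsonExpectation
  rw [← integral_const_mul, ← integral_neg]
  refine integral_congr_ae (ae_of_all _ fun U => ?_)
  show axialSign hL x * axialSign hL y * fermiIntegrand ρ 0 (fun _ => (meson x * meson y : FermiAlg (Site d L) N)) U =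
    -fermiIntegrand ρ 0 (fun _ => (meson x * meson y : FermiAlg (Site d L) N)) U
  rw [fermiIntegrand_eq_berezin_fermiBoltzmann, Complex.ofReal_zero]
  exact twoPoint_chiralGrading_torus_fixedGauge (even_iff_two_dvd.1 hL) NeZero.one_le apSign _ x y

omit [Fact (1 < L)] in
/-- **(3.106) for the coupled expectation at every real `β`**: `ε(x)ε(y) ⟨ψ̄ψ(x)ψ̄ψ(y)⟩_{β,0} = −⟨ψ̄ψ(x)ψ̄ψ(y)⟩_{β,0}`
(`T̂(k + π̂) = −T̂(k)`). [cite: SalmhoferSeiler1991, (3.106)] -/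
theorem twoPoint_chiralGrading_expect (hL : Even L) (β : ℝ) (x y : Site d L) :
    axialSign hL x * axialSign hL y *
        expect ρ β 0 (fun _ : GaugeConfig d L G => (meson x * meson y : FermiAlg (Site d L) N)) =
      -expect ρ β 0 (fun _ : GaugeConfig d L G => (meson x * meson y : FermiAlg (Site d L) N)) := by
  rw [expect, mul_div_assoc', twoPoint_chiralGrading_bracket ρ hL, neg_div]

omit [NeZero d] [NeZero L] [Fact (1 < L)] [LinearOrder (Site d L)] [Group G] [TopologicalSpace G] [IsTopologicalGroup G]
  [CompactSpace G] [MeasurableSpace G] [BorelSpace G] in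
/-- `ε(x)² = 1`. [cite: SalmhoferSeiler1991, §2 (2.8)] -/
theorem axialSign_mul_self (hL : Even L) (x : Site d L) : axialSign hL x * axialSign hL x = 1 := by
  unfold axialSign ComplexSpin.sgn; split_ifs <;> norm_num

omit [Fact (1 < L)] in
/-- **(3.101) for the coupled expectation at every real `β`**: at `m = 0` the `ψ̄ψ` two-point function
vanishes between sites of equal parity, `⟨ψ̄ψ(x)ψ̄ψ(y)⟩_{β,0} = 0` if `ε(x) = ε(y)`. [cite: SalmhoferSeiler1991, (3.101)] -/
theorem expect_meson_meson_massZero (hL : Even L) (β : ℝ) {x y : Site d L} (hxy : axialSign hL x = axialSign hL y) :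
    expect ρ β 0 (fun _ : GaugeConfig d L G => (meson x * meson y : FermiAlg (Site d L) N)) = 0 := by
  have h := twoPoint_chiralGrading_expect (G := G) (N := N) ρ hL β x y
  rw [hxy, axialSign_mul_self, one_mul] at h
  -- `E = -E` in `ℂ`
  have h2 : (2 : ℂ) * expect ρ β 0 (fun _ : GaugeConfig d L G => (meson x * meson y : FermiAlg (Site d L) N)) = 0 := by
    rw [two_mul]; nth_rewrite 2 [h]; exact add_neg_cancel _
  exact (mul_eq_zero.1 h2).resolve_left two_ne_zero

end StaggeredRP

end Literature.MathematicalPhysics.QuantumLattice
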